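import Mathlib
import HarnessLib
import Summits.HubbardSuperconductivity.HubbardSuperconductivity.Theorems.KLProgrammeKLRegimeEngineTowerBookkeepingSharp

/-!
# Route `KLProgramme` — crux K3 ENGINE (stmt-HubbardSuperconductivity-20437 `KLRegimeEngineV17F2`), stub (b): the blocked-tower bookkeeping,
# part 5a — the generic step from CHERNOFF DATA; the six-leg re-measurement at its own ratio; the four-piece profile (E1 lead r2d-p2 g5)

The re-measurement gain of parts 2/4 is `g^{(m−2)·(jump)}` in every degree `2m ≥ 6` — the relative sector count with exponent `L − 3`.  On the torus the
tree holds only exponent `L − 2` today (p4's one-determined-leg count), marginal exactly at `m = 3`; `L − 3` is in print (BGM06 Lemma A3.1 ⇐ BGM03 §7)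
and booked («RelativeThinSectorCount6», k3c2-p3 KL l.2962).  So that the bookkeeping is provable with WHATEVER strictly sub-marginal six-leg count lands
first (exponent `4 − η`, ratio `g₃ = 2^{−ηd}` per block), the six-leg ratio is separated and the six-leg measured size becomes a fourth import-like piece:

* **`towerStep_le_of_chernoff`** (T2-gen) — the block step in closed form from CHERNOFF DATA only: any `w ≥ 1`, any bounds `towerFO ≤ F`,
  `Σ_δ τ^δ μ(δ) w^{δ−1} ≤ G`, `towerV ≤ V̄` with `ΦG < 1`, `ΦV̄ < 1` give `b ≤ F + e ψ^p (w^{p−1})⁻¹ G · ΦG/(1−ΦG)` (common core of T2/T2♯/T3₄);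
* `towerMeasured_three_le` (T1₃) — `μ k 3 ≤ Σ_{k'≤k} c₁c₂³ g₃^{k+1−k'} b k' 3`, `b k' 3 ≤ Aλ²Q³` ⇒ `μ k 3 ≤ (c₁c₂³AQ³·g₃/(1−g₃))·λ²`;
* `sum_fourPiece_le`, `towerV_le_fourPiece`, `towerFO_le_of_four_le` — the FOUR-PIECE profile `μ 1 ≤ ι₁λ`, `μ 2 ≤ ι₂λ`, `μ 3 ≤ ι₃λ²`,
  `μ m ≤ A'λ^{m−1}Q'^m` (`m ≥ 4`): Chernoff sum `≤ τ·(ι₁λ + ι₂/(2Q') + ι₃/(4Q'²) + A'Q'/4)` at `w = (2τQ'λ)⁻¹`.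
Part 5b (`…TowerBookkeepingEta`): the induction `towerBorn_le_law₄`.  Pure real analysis; nothing about the model is asserted.
-/

noncomputable section

namespace Summit.HubbardSuperconductivity.HubbardSuperconductivity.Theorems.EngineV8

set_option linter.dupNamespace false -- summit = problem name (single-conjunct summit), D-0017

open Real Finset

/-! ## §1 (T2-gen) The block step from Chernoff data -/

/-- **(T2-gen) The block step in closed form from Chernoff data.**  For `0 ≤ μ`, a Chernoff parameter `w ≥ 1`, bounds `towerFO D σ μ p ≤ F`,
`Σ_{δ∈[1,D]} τ^δ μ(δ) w^{δ−1} ≤ G`, `towerV D τ μ ≤ V̄` with `Φ·G < 1` and `Φ·V̄ < 1`, the suppliers' step hypothesis (∀ N ≥ 2, under the guard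
`ΦV < 1`) gives `b ≤ F + e·ψ^p·(w^{p−1})⁻¹·G·(ΦG)/(1 − ΦG)`. -/
theorem towerStep_le_of_chernoff {D : ℕ} {μ : ℕ → ℝ} {b σ Φ ψ τ w F G Vb : ℝ}
    (hΦ : 0 ≤ Φ) (hψ : 0 ≤ ψ) (hτ : 0 ≤ τ) (hμ0 : ∀ m, 0 ≤ μ m) (hw : 1 ≤ w)
    {p : ℕ} (hFp : towerFO D σ μ p ≤ F)
    (hG : ∑ δ ∈ Icc 1 D, τ ^ δ * μ δ * w ^ (δ - 1) ≤ G) (hVb : towerV D τ μ ≤ Vb) (hyG : Φ * G < 1) (hθ : Φ * Vb < 1)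
    (hstep : ∀ N : ℕ, 2 ≤ N → Φ * towerV D τ μ < 1 →
      b ≤ towerFO D σ μ p + ∑ n ∈ Icc 2 N, exp 1 * Φ ^ (n - 1) * ψ ^ p * towerS D τ μ n p +
        ψ ^ p * exp 1 * towerV D τ μ * (Φ * towerV D τ μ) ^ N / (1 - Φ * towerV D τ μ)) :
    b ≤ F + exp 1 * ψ ^ p * (w ^ (p - 1))⁻¹ * G * (Φ * G / (1 - Φ * G)) := by
  set V := towerV D τ μ with hVdef
  have hV0 : 0 ≤ V := towerV_nonneg hτ hμ0
  have hθ0 : 0 ≤ Φ * V := mul_nonneg hΦ hV0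
  have hθle : Φ * V ≤ Φ * Vb := mul_le_mul_of_nonneg_left hVb hΦ
  have hθ1 : Φ * V < 1 := hθle.trans_lt hθ
  have hθb0 : 0 ≤ Φ * Vb := hθ0.trans hθle
  have hVb0 : 0 ≤ Vb := hV0.trans hVb
  have hw0 : 0 < w := one_pos.trans_le hw
  have hG0 : 0 ≤ G := (sum_nonneg fun δ _ => by have := hμ0 δ; positivity).trans hG
  have hy0 : 0 ≤ Φ * G := mul_nonneg hΦ hG0
  set M := exp 1 * ψ ^ p * (w ^ (p - 1))⁻¹ * G with hM
  have hM0 : 0 ≤ M := by positivity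
  set T : ℕ → ℝ := fun N => ψ ^ p * exp 1 * Vb * (Φ * Vb) ^ N / (1 - Φ * Vb) with hT
  -- graded partial sums
  have hGr : ∀ N, ∑ n ∈ Icc 2 N, exp 1 * Φ ^ (n - 1) * ψ ^ p * towerS D τ μ n p ≤ M * (Φ * G / (1 - Φ * G)) := by
    intro N
    have hterm : ∀ n ∈ Icc 2 N, exp 1 * Φ ^ (n - 1) * ψ ^ p * towerS D τ μ n p ≤ M * (Φ * G) ^ (n - 1) := by
      intro n hn
      have hS := towerS_le_chernoff (D := D) hτ hμ0 hw n p
      have hS0 : 0 ≤ ∑ δ ∈ Icc 1 D, τ ^ δ * μ δ * w ^ (δ - 1) := sum_nonneg fun δ _ => by have := hμ0 δ; positivity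
      have hpow : (∑ δ ∈ Icc 1 D, τ ^ δ * μ δ * w ^ (δ - 1)) ^ n ≤ G ^ n := pow_le_pow_left₀ hS0 hG n
      calc exp 1 * Φ ^ (n - 1) * ψ ^ p * towerS D τ μ n p
          ≤ exp 1 * Φ ^ (n - 1) * ψ ^ p * ((w ^ (p - 1))⁻¹ * G ^ n) := by
            have := towerS_nonneg hτ hμ0 n p (D := D)
            have h2 : towerS D τ μ n p ≤ (w ^ (p - 1))⁻¹ * G ^ n := hS.trans (mul_le_mul_of_nonneg_left hpow (by positivity))
            gcongr
        _ = M * (Φ * G) ^ (n - 1) := by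
            rw [hM]
            obtain ⟨j, rfl⟩ : ∃ j, n = j + 1 := ⟨n - 1, by have := (mem_Icc.1 hn).1; omega⟩
            simp only [Nat.add_sub_cancel, pow_succ, mul_pow]
            ring
    refine (sum_le_sum hterm).trans ?_
    rw [← mul_sum]
    exact mul_le_mul_of_nonneg_left (sum_Icc_two_pow_sub_one_le hy0 hyG N) hM0
  -- tail
  have hTail : ∀ N, ψ ^ p * exp 1 * V * (Φ * V) ^ N / (1 - Φ * V) ≤ T N := by
    intro N
    have h1 : 0 < 1 - Φ * Vb := sub_pos.2 hθ
    have h2 : 1 - Φ * Vb ≤ 1 - Φ * V := by linarith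
    rw [hT]
    dsimp only
    rw [div_eq_mul_inv, div_eq_mul_inv]
    have hinv : (1 - Φ * V)⁻¹ ≤ (1 - Φ * Vb)⁻¹ := inv_anti₀ h1 h2
    have hpowN : (Φ * V) ^ N ≤ (Φ * Vb) ^ N := pow_le_pow_left₀ hθ0 hθle N
    have : 0 ≤ (1 - Φ * V)⁻¹ := inv_nonneg.2 (sub_nonneg.2 hθ1.le)
    gcongr
  have hbN : ∀ N, 2 ≤ N → b ≤ F + M * (Φ * G / (1 - Φ * G)) + T N := fun N hN =>
    (hstep N hN hθ1).trans (add_le_add_three hFp (hGr N) (hTail N))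
  have hTto : Filter.Tendsto T Filter.atTop (nhds 0) := by
    have h := (tendsto_pow_atTop_nhds_zero_of_lt_one hθb0 hθ).mul_const ((1 - Φ * Vb)⁻¹) |>.const_mul (ψ ^ p * exp 1 * Vb)
    rw [zero_mul, mul_zero] at h
    refine h.congr' (Filter.Eventually.of_forall fun N => ?_)
    rw [hT]
    dsimp only
    rw [div_eq_mul_inv]
    ring
  have hlim : Filter.Tendsto (fun N => F + M * (Φ * G / (1 - Φ * G)) + T N) Filter.atTop (nhds (F + M * (Φ * G / (1 - Φ * G)))) := by
    have := hTto.const_add (F + M * (Φ * G / (1 - Φ * G)))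
    rwa [add_zero] at this
  have := ge_of_tendsto hlim (Filter.eventually_atTop.2 ⟨2, fun N hN => hbN N hN⟩)
  rw [hM] at this
  exact this

/-! ## §2 The six-leg re-measurement at its own ratio, and the four-piece profile -/

/-- `Σ_{m ∈ [1,D], a+1 ≤ m} x^{m−1} ≤ x^a/(1−x)` for `0 ≤ x < 1`. -/
theorem sum_Icc_ite_pow_le_of_le {x : ℝ} (hx0 : 0 ≤ x) (hx1 : x < 1) (a D : ℕ) :
    ∑ m ∈ Icc 1 D, (if a + 1 ≤ m then x ^ (m - 1) else 0) ≤ x ^ a / (1 - x) := by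
  rw [← sum_filter]
  have hI : (Icc 1 D).filter (fun m => a + 1 ≤ m) = Ico (a + 1) (D + 1) := by
    ext m; simp only [mem_filter, mem_Icc, mem_Ico]; omega
  rw [hI, sum_Ico_eq_sum_range]
  have h := geom_sum_Ico_le_of_lt_one hx0 hx1 (m := 0) (n := D + 1 - (a + 1))
  rw [pow_zero, ← range_eq_Ico] at h
  calc ∑ i ∈ range (D + 1 - (a + 1)), x ^ (a + 1 + i - 1) = x ^ a * ∑ i ∈ range (D + 1 - (a + 1)), x ^ i := by
        rw [mul_sum]; exact sum_congr rfl fun i _ => by rw [← pow_add]; congr 1; omega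
    _ ≤ x ^ a * (1 / (1 - x)) := mul_le_mul_of_nonneg_left h (pow_nonneg hx0 a)
    _ = x ^ a / (1 - x) := by rw [mul_one_div]

/-- **(T1₃) Six-leg re-measurement at ratio `g₃`**: `μ k 3 ≤ Σ_{k'≤k} c₁c₂³ g₃^{k+1−k'} b k' 3` with `b k' 3 ≤ Aλ²Q³` for `k' ≤ k` gives
`μ k 3 ≤ (c₁c₂³AQ³·g₃/(1−g₃))·λ²` (any strictly sub-marginal six-leg count: `g₃ = 2^{−ηd}`, `η > 0`). -/
theorem towerMeasured_three_le {b μ : ℕ → ℕ → ℝ} {A lam Q g₃ c₁ c₂ : ℝ}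
    (hA : 0 ≤ A) (hQ : 0 ≤ Q) (hg0 : 0 ≤ g₃) (hg1 : g₃ < 1) (hc₁ : 0 ≤ c₁) (hc₂ : 0 ≤ c₂) (hb0 : ∀ k m, 0 ≤ b k m) {k : ℕ}
    (hμ : μ k 3 ≤ ∑ k' ∈ range (k + 1), c₁ * c₂ ^ 3 * g₃ ^ (k + 1 - k') * b k' 3)
    (hborn : ∀ k' ≤ k, b k' 3 ≤ A * lam ^ 2 * Q ^ 3) :
    μ k 3 ≤ c₁ * c₂ ^ 3 * A * Q ^ 3 * (g₃ / (1 - g₃)) * lam ^ 2 := by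
  refine hμ.trans ?_
  have hterm : ∀ k' ∈ range (k + 1), c₁ * c₂ ^ 3 * g₃ ^ (k + 1 - k') * b k' 3 ≤ (c₁ * c₂ ^ 3 * (A * lam ^ 2 * Q ^ 3)) * g₃ ^ (k - k' + 1) := by
    intro k' hk'
    have hk'le : k' ≤ k := Nat.lt_succ_iff.1 (mem_range.1 hk')
    rw [show k + 1 - k' = k - k' + 1 by omega]
    have := hborn k' hk'le
    have := hb0 k' 3
    calc c₁ * c₂ ^ 3 * g₃ ^ (k - k' + 1) * b k' 3 ≤ c₁ * c₂ ^ 3 * g₃ ^ (k - k' + 1) * (A * lam ^ 2 * Q ^ 3) := by gcongr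
      _ = _ := by ring
  refine (sum_le_sum hterm).trans ?_
  rw [← mul_sum]
  have hgeom : ∑ k' ∈ range (k + 1), g₃ ^ (k - k' + 1) ≤ g₃ / (1 - g₃) := by
    have hrefl := sum_range_reflect (fun t => g₃ ^ (t + 1)) (k + 1)
    have : ∑ k' ∈ range (k + 1), g₃ ^ (k - k' + 1) = ∑ t ∈ range (k + 1), g₃ ^ (t + 1) := by
      rw [← hrefl]; exact sum_congr rfl fun j _ => by simp only [Nat.add_sub_cancel]
    rw [this]
    exact sum_range_pow_succ_le hg0 hg1 _
  calc c₁ * c₂ ^ 3 * (A * lam ^ 2 * Q ^ 3) * ∑ k' ∈ range (k + 1), g₃ ^ (k - k' + 1)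
      ≤ c₁ * c₂ ^ 3 * (A * lam ^ 2 * Q ^ 3) * (g₃ / (1 - g₃)) := mul_le_mul_of_nonneg_left hgeom (by positivity)
    _ = _ := by ring

/-- **The Chernoff sum of the four-piece profile at `w = (2τQ'λ)⁻¹`**: `μ 1 ≤ ι₁λ`, `μ 2 ≤ ι₂λ`, `μ 3 ≤ ι₃λ²`, `μ m ≤ A'λ^{m−1}Q'^m` (`4 ≤ m ≤ D`),
`0 < λ, τ, Q'` ⇒ `Σ_{δ∈[1,D]} τ^δ μ(δ) w^{δ−1} ≤ τ·(ι₁λ + ι₂/(2Q') + ι₃/(4Q'²) + A'Q'/4)`. -/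
theorem sum_fourPiece_le {D : ℕ} {τ lam Q' A' ι₁ ι₂ ι₃ : ℝ} {μ : ℕ → ℝ} (hτ : 0 < τ) (hlam : 0 < lam) (hQ' : 0 < Q') (hA' : 0 ≤ A')
    (hμ0 : ∀ m, 0 ≤ μ m) (hι₁ : μ 1 ≤ ι₁ * lam) (hι₂ : μ 2 ≤ ι₂ * lam) (hι₃ : μ 3 ≤ ι₃ * lam ^ 2)
    (hprof : ∀ m, 4 ≤ m → m ≤ D → μ m ≤ A' * lam ^ (m - 1) * Q' ^ m) :
    ∑ δ ∈ Icc 1 D, τ ^ δ * μ δ * ((2 * τ * Q' * lam)⁻¹) ^ (δ - 1) ≤ τ * (ι₁ * lam + ι₂ / (2 * Q') + ι₃ / (4 * Q' ^ 2) + A' * Q' / 4) := by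
  set w : ℝ := (2 * τ * Q' * lam)⁻¹ with hwdef
  have hx0 : 0 < 2 * τ * Q' * lam := by positivity
  have hι₁0 : 0 ≤ ι₁ * lam := (hμ0 1).trans hι₁
  have hι₂0' : 0 ≤ ι₂ := by
    by_contra h
    exact absurd ((hμ0 2).trans hι₂) (not_le.2 (mul_neg_of_neg_of_pos (not_le.1 h) hlam))
  have hι₃0' : 0 ≤ ι₃ := by
    by_contra h
    exact absurd ((hμ0 3).trans hι₃) (not_le.2 (mul_neg_of_neg_of_pos (not_le.1 h) (by positivity)))
  set f : ℕ → ℝ := fun δ => (if 1 = δ then τ * (ι₁ * lam) else 0) + (if 2 = δ then τ * (ι₂ / (2 * Q')) else 0) +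
    (if 3 = δ then τ * (ι₃ / (4 * Q' ^ 2)) else 0) + τ * (A' * Q') * (if 3 + 1 ≤ δ then (1 / 2 : ℝ) ^ (δ - 1) else 0) with hf
  have hkey : ∀ δ, 1 ≤ δ → τ ^ δ * (lam ^ (δ - 1) * Q' ^ δ) * w ^ (δ - 1) = τ * Q' * (1 / 2 : ℝ) ^ (δ - 1) := by
    intro δ hδ
    obtain ⟨j, rfl⟩ : ∃ j, δ = j + 1 := ⟨δ - 1, by omega⟩
    rw [Nat.add_sub_cancel, hwdef, inv_pow, pow_succ, pow_succ, one_div, inv_pow]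
    have h2 : (2 : ℝ) ^ j ≠ 0 := pow_ne_zero _ two_ne_zero
    have : (2 * τ * Q' * lam) ^ j ≠ 0 := pow_ne_zero _ hx0.ne'
    field_simp
    rw [mul_pow, mul_pow, mul_pow]
    ring
  have hterm : ∀ δ ∈ Icc 1 D, τ ^ δ * μ δ * w ^ (δ - 1) ≤ f δ := by
    intro δ hδ
    have hδ1 := (mem_Icc.1 hδ).1
    rw [hf]
    dsimp only
    rcases Nat.lt_or_ge δ 4 with h4 | h4
    · interval_cases δ
      · simp only [if_true, show ¬ (2 : ℕ) = 1 by decide, show ¬ (3 : ℕ) = 1 by decide, if_false, show ¬ 3 + 1 ≤ 1 by decide, pow_one,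
          Nat.sub_self, pow_zero, mul_one, add_zero, mul_zero]
        exact mul_le_mul_of_nonneg_left hι₁ hτ.le
      · simp only [show ¬ (1 : ℕ) = 2 by decide, show ¬ (3 : ℕ) = 2 by decide, if_false, if_true, show ¬ 3 + 1 ≤ 2 by decide, zero_add,
          add_zero, mul_zero, show 2 - 1 = 1 from rfl, pow_one]
        calc τ ^ 2 * μ 2 * w ≤ τ ^ 2 * (ι₂ * lam) * w := by gcongr
          _ = τ * (ι₂ / (2 * Q')) := by rw [hwdef]; field_simp
      · simp only [show ¬ (1 : ℕ) = 3 by decide, show ¬ (2 : ℕ) = 3 by decide, if_false, if_true, show ¬ 3 + 1 ≤ 3 by decide, zero_add,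
          add_zero, mul_zero, show 3 - 1 = 2 from rfl]
        calc τ ^ 3 * μ 3 * w ^ 2 ≤ τ ^ 3 * (ι₃ * lam ^ 2) * w ^ 2 := by gcongr
          _ = τ * (ι₃ / (4 * Q' ^ 2)) := by rw [hwdef]; field_simp; ring
    · rw [if_neg (by omega), if_neg (by omega), if_neg (by omega), if_pos (by omega), zero_add, zero_add, zero_add]
      calc τ ^ δ * μ δ * w ^ (δ - 1) ≤ τ ^ δ * (A' * lam ^ (δ - 1) * Q' ^ δ) * w ^ (δ - 1) := by
            have := hprof δ h4 (mem_Icc.1 hδ).2; gcongr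
        _ = A' * (τ ^ δ * (lam ^ (δ - 1) * Q' ^ δ) * w ^ (δ - 1)) := by ring
        _ = τ * (A' * Q') * (1 / 2 : ℝ) ^ (δ - 1) := by rw [hkey δ (by omega)]; ring
  refine (sum_le_sum hterm).trans ?_
  rw [hf, sum_add_distrib, sum_add_distrib, sum_add_distrib, sum_ite_eq, sum_ite_eq, sum_ite_eq, ← mul_sum]
  have h1 : (if 1 ∈ Icc 1 D then τ * (ι₁ * lam) else 0) ≤ τ * (ι₁ * lam) := by
    split_ifs
    · exact le_rfl
    · positivity
  have h2 : (if 2 ∈ Icc 1 D then τ * (ι₂ / (2 * Q')) else 0) ≤ τ * (ι₂ / (2 * Q')) := by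
    split_ifs
    · exact le_rfl
    · positivity
  have h3 : (if 3 ∈ Icc 1 D then τ * (ι₃ / (4 * Q' ^ 2)) else 0) ≤ τ * (ι₃ / (4 * Q' ^ 2)) := by
    split_ifs
    · exact le_rfl
    · positivity
  -- `Σ_{δ ≥ 4} (1/2)^{δ−1} ≤ (1/2)³/(1−1/2) = 1/4`
  have h4 : ∑ δ ∈ Icc 1 D, (if 3 + 1 ≤ δ then (1 / 2 : ℝ) ^ (δ - 1) else 0) ≤ 1 / 4 :=
    (sum_Icc_ite_pow_le_of_le (x := (1 / 2 : ℝ)) (by norm_num) (by norm_num) 3 D).trans (by norm_num)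
  have h4' : τ * (A' * Q') * ∑ δ ∈ Icc 1 D, (if 3 + 1 ≤ δ then (1 / 2 : ℝ) ^ (δ - 1) else 0) ≤ τ * (A' * Q') * (1 / 4) :=
    mul_le_mul_of_nonneg_left h4 (by positivity)
  calc _ ≤ τ * (ι₁ * lam) + τ * (ι₂ / (2 * Q')) + τ * (ι₃ / (4 * Q' ^ 2)) + τ * (A' * Q') * (1 / 4) :=
        add_le_add (add_le_add_three h1 h2 h3) h4'
    _ = τ * (ι₁ * lam + ι₂ / (2 * Q') + ι₃ / (4 * Q' ^ 2) + A' * Q' / 4) := by ring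

/-- **The field-weighted norm of the four-piece profile**:
`towerV D τ μ ≤ eτ·ι₁λ + (eτ)²·ι₂λ + (eτ)³·ι₃λ² + A'·eτQ'·x₃³/(1−x₃)`, `x₃ = eτλQ' < 1`. -/
theorem towerV_le_fourPiece {D : ℕ} {τ lam Q' A' ι₁ ι₂ ι₃ : ℝ} {μ : ℕ → ℝ} (hτ : 0 ≤ τ) (hlam : 0 ≤ lam) (hQ' : 0 ≤ Q') (hA' : 0 ≤ A')
    (hμ0 : ∀ m, 0 ≤ μ m) (hι₁ : μ 1 ≤ ι₁ * lam) (hι₂ : μ 2 ≤ ι₂ * lam) (hι₃ : μ 3 ≤ ι₃ * lam ^ 2)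
    (hprof : ∀ m, 4 ≤ m → m ≤ D → μ m ≤ A' * lam ^ (m - 1) * Q' ^ m) (hx₃ : exp 1 * τ * lam * Q' < 1) :
    towerV D τ μ ≤ exp 1 * τ * (ι₁ * lam) + (exp 1 * τ) ^ 2 * (ι₂ * lam) + (exp 1 * τ) ^ 3 * (ι₃ * lam ^ 2) +
      A' * (exp 1 * τ * Q') * ((exp 1 * τ * lam * Q') ^ 3 / (1 - exp 1 * τ * lam * Q')) := by
  have hx0 : 0 ≤ exp 1 * τ * lam * Q' := by positivity
  have hι₁0 : 0 ≤ ι₁ * lam := (hμ0 1).trans hι₁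
  have hι₂0 : 0 ≤ ι₂ * lam := (hμ0 2).trans hι₂
  have hι₃0 : 0 ≤ ι₃ * lam ^ 2 := (hμ0 3).trans hι₃
  set f : ℕ → ℝ := fun m => (if 1 = m then exp 1 * τ * (ι₁ * lam) else 0) + (if 2 = m then (exp 1 * τ) ^ 2 * (ι₂ * lam) else 0) +
    (if 3 = m then (exp 1 * τ) ^ 3 * (ι₃ * lam ^ 2) else 0) +
    A' * (exp 1 * τ * Q') * (if 3 + 1 ≤ m then (exp 1 * τ * lam * Q') ^ (m - 1) else 0) with hf
  have hterm : ∀ m ∈ Icc 1 D, (exp 1 * τ) ^ m * μ m ≤ f m := by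
    intro m hm
    have hm1 := (mem_Icc.1 hm).1
    rw [hf]
    dsimp only
    rcases Nat.lt_or_ge m 4 with h4 | h4
    · interval_cases m
      · simp only [if_true, show ¬ (2 : ℕ) = 1 by decide, show ¬ (3 : ℕ) = 1 by decide, if_false, show ¬ 3 + 1 ≤ 1 by decide, pow_one,
          add_zero, mul_zero]
        exact mul_le_mul_of_nonneg_left hι₁ (by positivity)
      · simp only [show ¬ (1 : ℕ) = 2 by decide, show ¬ (3 : ℕ) = 2 by decide, if_false, if_true, show ¬ 3 + 1 ≤ 2 by decide, zero_add,
          add_zero, mul_zero]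
        exact mul_le_mul_of_nonneg_left hι₂ (by positivity)
      · simp only [show ¬ (1 : ℕ) = 3 by decide, show ¬ (2 : ℕ) = 3 by decide, if_false, if_true, show ¬ 3 + 1 ≤ 3 by decide, zero_add,
          add_zero, mul_zero]
        exact mul_le_mul_of_nonneg_left hι₃ (by positivity)
    · rw [if_neg (by omega), if_neg (by omega), if_neg (by omega), if_pos (by omega), zero_add, zero_add, zero_add]
      calc (exp 1 * τ) ^ m * μ m ≤ (exp 1 * τ) ^ m * (A' * lam ^ (m - 1) * Q' ^ m) := by
            have := hprof m h4 (mem_Icc.1 hm).2; have := hμ0 m; gcongr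
        _ = A' * (exp 1 * τ * Q') * (exp 1 * τ * lam * Q') ^ (m - 1) := by
            obtain ⟨j, rfl⟩ : ∃ j, m = j + 1 := ⟨m - 1, by omega⟩
            simp only [Nat.add_sub_cancel, pow_succ, mul_pow]
            ring
  unfold towerV
  refine (sum_le_sum hterm).trans ?_
  rw [hf, sum_add_distrib, sum_add_distrib, sum_add_distrib, sum_ite_eq, sum_ite_eq, sum_ite_eq, ← mul_sum]
  have h1 : (if 1 ∈ Icc 1 D then exp 1 * τ * (ι₁ * lam) else 0) ≤ exp 1 * τ * (ι₁ * lam) := by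
    split_ifs
    · exact le_rfl
    · positivity
  have h2 : (if 2 ∈ Icc 1 D then (exp 1 * τ) ^ 2 * (ι₂ * lam) else 0) ≤ (exp 1 * τ) ^ 2 * (ι₂ * lam) := by
    split_ifs
    · exact le_rfl
    · positivity
  have h3 : (if 3 ∈ Icc 1 D then (exp 1 * τ) ^ 3 * (ι₃ * lam ^ 2) else 0) ≤ (exp 1 * τ) ^ 3 * (ι₃ * lam ^ 2) := by
    split_ifs
    · exact le_rfl
    · positivity
  exact add_le_add (add_le_add_three h1 h2 h3) (mul_le_mul_of_nonneg_left (sum_Icc_ite_pow_le_of_le hx0 hx₃ 3 D) (by positivity))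

/-- **First order with the profile only from degree eight**: for `3 ≤ p`, `towerFO D σ μ p ≤ A'λ^{p−1}(4Q')^p·x₁/(1−x₁)` from `μ m ≤ A'λ^{m−1}Q'^m`
(`4 ≤ m ≤ D`) alone. -/
theorem towerFO_le_of_four_le {D : ℕ} {σ A' lam Q' : ℝ} {μ : ℕ → ℝ} (hσ : 0 ≤ σ) (hA' : 0 ≤ A') (hlam : 0 ≤ lam) (hQ' : 0 ≤ Q')
    (hμ0 : ∀ m, 0 ≤ μ m) (hprof : ∀ m, 4 ≤ m → m ≤ D → μ m ≤ A' * lam ^ (m - 1) * Q' ^ m)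
    (hx₁ : 4 * σ * lam * Q' < 1) {p : ℕ} (hp : 3 ≤ p) :
    towerFO D σ μ p ≤ A' * lam ^ (p - 1) * (4 * Q') ^ p * (4 * σ * lam * Q' / (1 - 4 * σ * lam * Q')) := by
  set μ' : ℕ → ℝ := fun m => if 4 ≤ m then μ m else 0 with hμ'
  have hμ'0 : ∀ m, 0 ≤ μ' m := fun m => by rw [hμ']; dsimp only; split_ifs; exacts [hμ0 m, le_rfl]
  have hprof' : ∀ m, 1 ≤ m → m ≤ D → μ' m ≤ A' * lam ^ (m - 1) * Q' ^ m := fun m _ hmD => by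
    rw [hμ']; dsimp only; split_ifs with h4
    · exact hprof m h4 hmD
    · positivity
  have heq : towerFO D σ μ p = towerFO D σ μ' p := by
    unfold towerFO
    refine sum_congr rfl fun m hm => ?_
    rw [hμ']; dsimp only
    rw [if_pos (by have := (mem_Ioc.1 hm).1; omega)]
  rw [heq]
  exact towerFO_le hσ hA' hlam hQ' hμ'0 hprof' hx₁ (by omega)

end Summit.HubbardSuperconductivity.HubbardSuperconductivity.Theorems.EngineV8

end
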